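import Literature.MathematicalPhysics.KineticTheory.SeparablePairBand
import Literature.MathematicalPhysics.KineticTheory.PinnedChainCollisionOperator
import Mathlib.Analysis.SpecialFunctions.Integrability.Basic
import Mathlib.Analysis.Fourier.AddCircle
import HarnessLib

/-!
# The one-dimensional van Hove edge on the Brillouin circle: a quadratic band maximum makes the
# threshold integral diverge, hence binds for every coupling of the binding sign

Topic `Literature/MathematicalPhysics/KineticTheory` (definition request `defn-SeparableTwoBodyTMatrix`, part
(ii), the concrete one-dimensional input of `SeparablePairBand.existsUnique_eigenvalue_above`).

On the circle `𝕋 = ℝ/2πℤ` with its Haar probability measure `dk` (`PinnedChainKinetic.𝕋`, `μ𝕋`) let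
`E : 𝕋 → ℝ` be a band with a STRICT, QUADRATICALLY NON-DEGENERATE maximum `E_max` at `p₀` —
`0 < E_max − E(p₀ + t) ≤ C t²` for `0 < |t| < δ` along the angle parametrisation — and let the form factor
`g` be continuous at `p₀` with `g(p₀) ≠ 0`. Then (PROVED, `lintegral_edge_eq_top`)

  `∫⁻ ‖g‖² / (E_max − E) dk = ∞`,

because near `p₀` the integrand is `≥ κ/(C t²)` and `∫₀^δ dt/t² = ∞` (`lintegral_Ioo_inv_sq_eq_top`, from
Mathlib's `integrableOn_Ioo_rpow_iff`). This is the divergence `G₀(E) → −∞` as `E → E_edge` of a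
one-dimensional band edge, `ρ₀ ∼ C(E − E_ℓ)^{-1/2}` [Economou1983, §6.2.3 eqs. (6.46)–(6.47)], in the form
consumed by `FiniteRank.existsUnique_eigenvalue_above`; the corollary `existsUnique_eigenvalue_above_circle`
states the conclusion for a continuous band and form factor on `𝕋`: for every `λ > 0` the rank-one operator
`M_E + λ|g⟩⟨g|` on `L²(𝕋, dk; ℂ)` has exactly one eigenvalue above the band
[Economou1983, §6.2.3 after (6.47): "there is always a bound state no matter how small |ε| is"].

Not here: the `λ²` law of the splitting (Economou (6.48)); the verification that the pinned-chain pair band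
`E_K(p) = ω(p) + ω(K − p)` (`PhononPairBand.lean`) has its maximum on the exchange diagonal and is
non-degenerate there (the requester's fibre analysis).

## References

* E. N. Economou, Green's Functions in Quantum Physics, 2nd ed., Springer 1983, §6.2.3 eqs. (6.46)–(6.48).
  [cite: Economou1983, §6.2.3 eqs. (6.46)–(6.48)]
-/

noncomputable section

open MeasureTheory Filter Set
open scoped ENNReal Topology

namespace Literature.MathematicalPhysics.KineticTheory.HeatConduction

namespace PinnedChainKinetic

/-- `∫₀^δ κ/(C t²) dt = ∞` for `κ, C, δ > 0` (the power `t⁻²` is not integrable at `0`). [folklore] -/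
theorem lintegral_Ioo_inv_sq_eq_top {κ C δ : ℝ} (hκ : 0 < κ) (hC : 0 < C) (hδ : 0 < δ) :
    ∫⁻ t in Ioo (0 : ℝ) δ, ENNReal.ofReal (κ / (C * t ^ 2)) = ∞ := by
  by_contra hne
  have hlt : ∫⁻ t in Ioo (0 : ℝ) δ, ENNReal.ofReal (κ / (C * t ^ 2)) < ∞ := lt_top_iff_ne_top.2 hne
  have hmeas : AEStronglyMeasurable (fun t : ℝ => κ / (C * t ^ 2)) (volume.restrict (Ioo 0 δ)) := by
    have : (fun t : ℝ => κ / (C * t ^ 2)) = fun t => κ * (C * t ^ 2)⁻¹ :=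
      funext fun t => div_eq_mul_inv _ _
    rw [this]
    exact (measurable_const.mul ((measurable_const.mul (measurable_id.pow_const 2)).inv)).aestronglyMeasurable
  have hint : IntegrableOn (fun t : ℝ => κ / (C * t ^ 2)) (Ioo 0 δ) :=
    ⟨hmeas, (hasFiniteIntegral_iff_ofReal (ae_of_all _ fun t => by positivity)).2 hlt⟩
  have hrpow : IntegrableOn (fun t : ℝ => t ^ (-2 : ℝ)) (Ioo 0 δ) := by
    refine IntegrableOn.congr_fun (f := fun t : ℝ => C / κ * (κ / (C * t ^ 2))) (hint.const_mul (C / κ))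
      (fun t ht => ?_) measurableSet_Ioo
    have ht0 : 0 < t := ht.1
    rw [Real.rpow_neg ht0.le, Real.rpow_two]
    field_simp
  have := (intervalIntegral.integrableOn_Ioo_rpow_iff hδ).1 hrpow
  norm_num at this

/-- **THE ONE-DIMENSIONAL VAN HOVE EDGE.** On the circle with its Haar probability measure: if the band
`E ≤ E_max` has a strict maximum at `p₀` with a quadratic upper bound, `0 < E_max − E(p₀ + t) ≤ C t²` for
`0 < |t| < δ`, and `g` is continuous at `p₀` with `g(p₀) ≠ 0`, then the threshold integral diverges:
`∫⁻ ‖g‖²/(E_max − E) dk = ∞`. [cite: Economou1983, §6.2.3 eqs. (6.46)–(6.47)] -/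
theorem lintegral_edge_eq_top {E : 𝕋 → ℝ} {g : 𝕋 → ℂ} {p₀ : 𝕋} {Emax C δ : ℝ} (hC : 0 < C)
    (hδ : 0 < δ) (hquad : ∀ t : ℝ, 0 < |t| → |t| < δ →
      0 < Emax - E (p₀ + (t : 𝕋)) ∧ Emax - E (p₀ + (t : 𝕋)) ≤ C * t ^ 2)
    (hg : ContinuousAt g p₀) (hg0 : g p₀ ≠ 0) :
    ∫⁻ p, ENNReal.ofReal (‖g p‖ ^ 2 / (Emax - E p)) ∂μ𝕋 = ∞ := by
  set F : 𝕋 → ℝ≥0∞ := fun p => ENNReal.ofReal (‖g p‖ ^ 2 / (Emax - E p)) with hF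
  -- (1) `‖g‖ ≥ ‖g p₀‖/2` near `p₀` along the angle parametrisation
  have hgc : ContinuousAt (fun t : ℝ => g (p₀ + (t : 𝕋))) 0 := by
    have h1 : Continuous fun t : ℝ => p₀ + (t : 𝕋) := continuous_const.add (AddCircle.continuous_mk' _)
    exact hg.comp_of_eq h1.continuousAt (by simp)
  have hpos0 : 0 < ‖g p₀‖ / 2 := by positivity
  obtain ⟨η, hη, hηg⟩ : ∃ η > 0, ∀ t : ℝ, |t| < η → ‖g p₀‖ / 2 ≤ ‖g (p₀ + (t : 𝕋))‖ := by
    obtain ⟨η, hη, h⟩ := Metric.continuousAt_iff.1 hgc (‖g p₀‖ / 2) hpos0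
    refine ⟨η, hη, fun t ht => ?_⟩
    have hd : dist t 0 < η := by simpa [Real.dist_eq] using ht
    have := h hd
    simp only [QuotientAddGroup.mk_zero, add_zero, dist_eq_norm] at this
    linarith [norm_sub_norm_le (g p₀) (g (p₀ + (t : 𝕋))), norm_sub_rev (g p₀) (g (p₀ + (t : 𝕋)))]
  -- (2) pointwise lower bound on `(0, δ')`
  set δ' := min (min δ η) (2 * Real.pi) with hδ'
  have hδ'pos : 0 < δ' := lt_min (lt_min hδ hη) Real.two_pi_pos
  set κ := (‖g p₀‖ / 2) ^ 2 with hκ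
  have hκpos : 0 < κ := by positivity
  have hpt : ∀ t ∈ Ioo (0 : ℝ) δ', ENNReal.ofReal (κ / (C * t ^ 2)) ≤ F (p₀ + (t : 𝕋)) := by
    intro t ht
    have hmin : δ' ≤ min δ η := min_le_left _ _
    have htδ : |t| < δ := by
      rw [abs_of_pos ht.1]; exact ht.2.trans_le (hmin.trans (min_le_left _ _))
    have htη : |t| < η := by
      rw [abs_of_pos ht.1]; exact ht.2.trans_le (hmin.trans (min_le_right _ _))
    obtain ⟨hpos, hle⟩ := hquad t (abs_pos.2 ht.1.ne') htδ
    refine ENNReal.ofReal_le_ofReal ?_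
    exact div_le_div₀ (sq_nonneg _) (pow_le_pow_left₀ hpos0.le (hηg t htη) 2) hpos hle
  -- (3) the chain: Haar integral = (2π)⁻¹ · Lebesgue integral over a period ≥ integral over (0, δ') = ∞
  have h1 : ∫⁻ p, F p ∂μ𝕋 = ∫⁻ q, F (p₀ + q) ∂μ𝕋 := (lintegral_add_left_eq_self F p₀).symm
  have h2 : ∫⁻ q, F (p₀ + q) ∂(volume : Measure 𝕋) =
      ENNReal.ofReal (2 * Real.pi) * ∫⁻ q, F (p₀ + q) ∂μ𝕋 := by
    rw [AddCircle.volume_eq_smul_haarAddCircle, lintegral_smul_measure, smul_eq_mul]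
  have h3 : ∫⁻ t in Ioc (0 : ℝ) (0 + 2 * Real.pi), F (p₀ + (t : 𝕋)) =
      ∫⁻ q, F (p₀ + q) ∂(volume : Measure 𝕋) :=
    AddCircle.lintegral_preimage (2 * Real.pi) 0 (fun q => F (p₀ + q))
  have h4 : ∫⁻ t in Ioo (0 : ℝ) δ', ENNReal.ofReal (κ / (C * t ^ 2)) ≤
      ∫⁻ t in Ioc (0 : ℝ) (0 + 2 * Real.pi), F (p₀ + (t : 𝕋)) :=
    calc ∫⁻ t in Ioo (0 : ℝ) δ', ENNReal.ofReal (κ / (C * t ^ 2))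
        ≤ ∫⁻ t in Ioo (0 : ℝ) δ', F (p₀ + (t : 𝕋)) := setLIntegral_mono' measurableSet_Ioo hpt
      _ ≤ ∫⁻ t in Ioc (0 : ℝ) (0 + 2 * Real.pi), F (p₀ + (t : 𝕋)) :=
          lintegral_mono_set fun t ht => ⟨ht.1, by rw [zero_add]; exact ht.2.le.trans (min_le_right _ _)⟩
  have h5 := lintegral_Ioo_inv_sq_eq_top hκpos hC hδ'pos
  have h6 : ENNReal.ofReal (2 * Real.pi) * ∫⁻ q, F (p₀ + q) ∂μ𝕋 = ∞ := by
    rw [← h2, ← h3]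
    exact eq_top_iff.2 (h5 ▸ h4)
  rw [h1]
  exact ((ENNReal.mul_eq_top.1 h6).resolve_right fun h => ENNReal.ofReal_ne_top h.1).2

/-- Continuous functions on the circle are in `L²(dk; ℂ)` (as in `HarmonicChaos.memLp_two_of_continuous_circle`,
restated to keep this file's imports light). [folklore] -/
theorem memLp_two_circle {g : 𝕋 → ℂ} (hg : Continuous g) : MemLp g 2 μ𝕋 := by
  obtain ⟨C, hC⟩ := isCompact_univ.exists_bound_of_continuousOn hg.continuousOn
  exact (memLp_top_of_bound hg.aestronglyMeasurable C
    (ae_of_all _ fun x => hC x (mem_univ x))).mono_exponent le_top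

/-- A continuous function on the circle that does not vanish identically has a non-zero `L²` class (Haar
measure charges open sets). [folklore] -/
theorem toLp_ne_zero_of_continuous {g : 𝕋 → ℂ} (hg : Continuous g) {p₀ : 𝕋} (hg0 : g p₀ ≠ 0) :
    (memLp_two_circle hg).toLp g ≠ 0 := by
  intro h0
  rw [Lp.eq_zero_iff_ae_eq_zero] at h0
  have hae : g =ᵐ[μ𝕋] (0 : 𝕋 → ℂ) := (memLp_two_circle hg).coeFn_toLp.symm.trans h0
  have : g = 0 := (hg.ae_eq_iff_eq μ𝕋 continuous_const).1 hae
  exact hg0 (by rw [this]; rfl)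

/-- **Every `λ > 0` binds above a non-degenerate band maximum on the circle.** For a continuous band `E` on
`𝕋` with `E ≤ E_max`, a strict quadratically non-degenerate maximum at `p₀` (as in `lintegral_edge_eq_top`),
and a continuous form factor `g` with `g(p₀) ≠ 0`: for every `λ > 0` the rank-one operator `M_E + λ|g⟩⟨g|`
on `L²(𝕋, dk; ℂ)` has EXACTLY ONE eigenvalue `x > E_max` (the anti-bound state split off the band top).
[cite: Economou1983, §6.2.3 eqs. (6.46)–(6.48)] -/
theorem existsUnique_eigenvalue_above_circle {E : 𝕋 → ℝ} (hE : Continuous E) {g : 𝕋 → ℂ}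
    (hg : Continuous g) {p₀ : 𝕋} {Emax C δ : ℝ} (hC : 0 < C) (hδ : 0 < δ) (hEmax : ∀ p, E p ≤ Emax)
    (hquad : ∀ t : ℝ, 0 < |t| → |t| < δ →
      0 < Emax - E (p₀ + (t : 𝕋)) ∧ Emax - E (p₀ + (t : 𝕋)) ≤ C * t ^ 2)
    (hg0 : g p₀ ≠ 0) {lam : ℝ} (hlam : 0 < lam) :
    ∃! x : ℝ, Emax < x ∧ ∃ ψ : Lp ℂ 2 μ𝕋, ψ ≠ 0 ∧
      FiniteRank.perturb₁ (FiniteRank.bandOp μ𝕋 E) (lam : ℂ)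
        ((memLp_two_circle hg).toLp g)
        ((memLp_two_circle hg).toLp g) ψ = (x : ℂ) • ψ := by
  obtain ⟨B, hB⟩ := isCompact_univ.exists_bound_of_continuousOn hE.continuousOn
  have hB' : ∀ p, |E p| ≤ B := fun p => by simpa [Real.norm_eq_abs] using hB p (mem_univ p)
  set u := (memLp_two_circle hg).toLp g with hu
  have hdiv : ∫⁻ p, ENNReal.ofReal (‖u p‖ ^ 2 / (Emax - E p)) ∂μ𝕋 = ∞ := by
    rw [← lintegral_edge_eq_top hC hδ hquad hg.continuousAt hg0]
    refine lintegral_congr_ae ?_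
    filter_upwards [(memLp_two_circle hg).coeFn_toLp] with p hp
    rw [hp]
  exact FiniteRank.existsUnique_eigenvalue_above hE.measurable hB' hEmax
    (toLp_ne_zero_of_continuous hg hg0) hdiv hlam

end PinnedChainKinetic

end Literature.MathematicalPhysics.KineticTheory.HeatConduction
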